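import Summits.ValiantsHypothesis.ValiantsHypothesis.Theorems.ValuativeGCTValuativeFlipDetEffectiveMonotone
import Summits.ValiantsHypothesis.ValiantsHypothesis.Theorems.ValuativeGCTValuativeFlipRayStability
import Summits.ValiantsHypothesis.ValiantsHypothesis.Theorems.ValuativeGCTValuativeFlipLiftSurjective

/-!
# Effective padding monotonicity of the determinant — ray form and consequences
# (crux `ValuativeGCT.ValuativeFlip`, stmt-ValiantsHypothesis-12624; wall-breaker axis
# "representation-stability transfer `m ↔ m + 1`", k16 gen 1, seat 3; sequel to
# `…DetEffectiveMonotone.lean`)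

Letters (as in `…RayStability.lean`): inner size `n ≥ 1`, degree `δ`, inner shape `μ ⊢ nδ` with at most
`n²` parts, padding `j`, level `n + j`; `K(j) = K_{n+j}((μ♯(n+j))*) = mult ℂ[Δ(det_{n+j})]`,
`P(j) = mult_{(μ♯)*} ℂ[Δ_{n+j}(X₀₀^j per_n)]`, `a(j) = a_{μ♯}(δ[n+j])`; write `J(m) = 2(m+1)^10 + 1`.

* `det_ray_mono_of_le` — **`K(j₁) ≤ K(j₂)` whenever `n + j₂ ≥ J(n + j₁)`**: the determinant's ray is
  monotone across every polynomially long step (no long-range drops), at every start, effectively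
  (`det_ray_eventually_ge` gave an ineffective `J`).
* `inner_det_lt_of_flip` — a flip `K(j) < P'` against ANY padded permanent at a level `n + j ≥ J(n)`… with
  `j ≥ 2(n+1)^10` forces `K_n(μ*) < P'`: tail witnesses on the Kadish–Landsberg ray of `μ` must beat the
  INNER determinant `det_n` on `μ`.
* `det_ray_eq_plethysm_of_eqFree_base`, `det_ray_eq_base_of_eqFree_base` — **effective propagation of
  equation-freeness**: if `Det_n` has no equation of type `μ*` in degree `δ` (`a_μ(δ[n]) ≤ K_n(μ*)`) and
  `μ₂ ≤ n`, then for every `j ≥ 2(n+1)^10`, `K(j) = a(j) = K_n(μ*)` — `Det_{n+j}` has no equation of type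
  `(μ♯)*` in degree `δ` either, and the ray is EXACTLY stable from an explicit threshold
  (exact plethysm stability `plethysmCoeff_rowLift_eq`, k4, + `det_paddingMonotone`).
* `det_base_lt_plethysm_of_ray_lt` — contrapositive: **equations of `Det_{n+j}` of type `(μ♯)*` descend to
  equations of `Det_n` of type `μ*`** (`μ₂ ≤ n`, `j ≥ 2(n+1)^10`).
* `paddedPer_le_det_ray_of_eqFree_base` — hence NO flip on the ray of an equation-free inner type beyond
  the threshold, against every padded permanent `X₀₀^{n+j-n'} per_{n'}`, `n' ≤ n + j` (an effective, ray-wise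
  form of `no_flip_of_eqFree`).

Sources: BLMW, SIAM J. Comput. 40 (2011) §6.4 Problem 6.10; Kadish–Landsberg, Commun. Algebra 42 (2014)
Question 1.5; Bürgisser–Ikenmeyer–Panova, J. AMS 32 (2019) Prop. 5.6(2); Weintraub 1990 / Brion 1993
(inner plethysm stability); Mulmuley–Sohoni 2001 Prop. 4.4.
-/

set_option linter.dupNamespace false

namespace Summit.ValiantsHypothesis.ValiantsHypothesis.Theorems.ValuativeFlip

open scoped BigOperators
open MvPolynomial
open Literature.NumberTheory.DiophantineGeometry
open Literature.Computability.AlgebraicComplexity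
open Literature.Computability.Complexity

noncomputable section

/-- **Effective monotonicity of the determinant's ray across polynomially long steps**: for
`μ ⊢ nδ` (`≤ n²` parts) and paddings `j₁, j₂` with `n + j₂ ≥ 2(n+j₁+1)^10 + 1`,
`K(j₁) ≤ K(j₂)` (`det_paddingMonotone_of_le` at level `n + j₁` for the shape `μ♯(n+j₁)`, and
`(μ♯(n+j₁))♯ = μ♯(n+j₂)`). [BLMW 2011 Problem 6.10 (det half, effective); this crux, k16] -/
theorem det_ray_mono_of_le (n δ : ℕ) [NeZero n] (μ : Nat.Partition (n * δ)) (hμ : μ.parts.card ≤ n * n)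
    (j₁ j₂ : ℕ) [NeZero (n + j₁)] [NeZero (n + j₂)] (h : 2 * (n + j₁ + 1) ^ 10 + 1 ≤ n + j₂) :
    orbitMultiplicity ℂ (detFormLex ℂ (n + j₁)) (n + j₁) (partitionWeightLex (n + j₁) (rowLift μ j₁)) ≤
      orbitMultiplicity ℂ (detFormLex ℂ (n + j₂)) (n + j₂) (partitionWeightLex (n + j₂) (rowLift μ j₂)) := by
  have hpow : n + j₁ + 1 ≤ (n + j₁ + 1) ^ 10 := Nat.le_self_pow (by norm_num) _
  have hle : j₁ ≤ j₂ := by omega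
  obtain ⟨j, rfl⟩ := Nat.exists_eq_add_of_le hle
  haveI : NeZero (n + j₁ + j) := ⟨by have := NeZero.ne n; omega⟩
  have h1 := det_paddingMonotone_of_le (n + j₁) δ (rowLift μ j₁) (card_parts_rowLift_le_sq μ hμ j₁) j
    (by omega)
  rwa [orbitMultiplicity_det_congr_level (m₂ := n + (j₁ + j)) (Nat.add_assoc n j₁ j)
    (rowLift (rowLift μ j₁) j) (rowLift μ (j₁ + j)) (parts_rowLift_rowLift μ j₁ j)] at h1

/-- **Tail witnesses on a Kadish–Landsberg ray must beat the INNER determinant.**  If at a level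
`n + j` with `j ≥ 2(n+1)^10` the shape `μ♯(n+j)` flips against some padded permanent
`X₀₀^{n+j-n'} per_{n'}` — `K(j) < mult_{(μ♯)*} ℂ[Δ_{n+j}(X₀₀^{n+j-n'} per_{n'})]` — then already
`K_n(μ*) < mult_{(μ♯)*} ℂ[Δ_{n+j}(X₀₀^{n+j-n'} per_{n'})]`.  With `P(j) ≤ P∞(μ)` (`per_rayStable`): a flip
anywhere on the ray of `μ` beyond the threshold needs `K_n(μ*) < P∞(μ)`. [this crux, k16] -/
theorem inner_det_lt_of_flip (n δ : ℕ) [NeZero n] (μ : Nat.Partition (n * δ)) (hμ : μ.parts.card ≤ n * n)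
    (j : ℕ) [NeZero (n + j)] (hj : 2 * (n + 1) ^ 10 ≤ j) {n' : ℕ}
    (hflip : orbitMultiplicity ℂ (detFormLex ℂ (n + j)) (n + j) (partitionWeightLex (n + j) (rowLift μ j)) <
      orbitMultiplicity ℂ (paddedPerFormLex ℂ n' (n + j)) (n + j) (partitionWeightLex (n + j) (rowLift μ j))) :
    orbitMultiplicity ℂ (detFormLex ℂ n) n (partitionWeightLex n μ) <
      orbitMultiplicity ℂ (paddedPerFormLex ℂ n' (n + j)) (n + j) (partitionWeightLex (n + j) (rowLift μ j)) :=
  lt_of_le_of_lt (det_paddingMonotone n δ μ hμ j hj) hflip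

/-- **Effective propagation of equation-freeness up a Kadish–Landsberg ray.**  If `Det_n = Δ(det_n)` has
no equation of type `μ*` in degree `δ` — `a_μ(δ[n]) ≤ K_n(μ*)` (hence `=`) — and `μ₂ ≤ n`, then for every
`j ≥ 2(n+1)^10` the determinant multiplicity on the ray equals the ambient plethysm coefficient:
`K(j) = a(j)`, i.e. `Det_{n+j}` has no equation of type `(μ♯(n+j))*` in degree `δ`.  Proof:
`K(j) ≤ a(j) = a(0) ≤ K(0) ≤ K(j)` (plethysm bound; exact inner plethysm stability
`plethysmCoeff_rowLift_eq`; hypothesis; `det_paddingMonotone`). [Bürgisser–Ikenmeyer–Panova 2019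
Prop. 5.6(2); BLMW 2011 §6.4; this crux, k4 + k16] -/
theorem det_ray_eq_plethysm_of_eqFree_base (n δ : ℕ) [NeZero n] (μ : Nat.Partition (n * δ))
    (hμ : μ.parts.card ≤ n * n) (h₂ : μ.sortedParts.getD 1 0 ≤ n)
    (hfree : plethysmCoeff ℂ (MatIdx n) n (partitionWeightLex n μ) ≤
      orbitMultiplicity ℂ (detFormLex ℂ n) n (partitionWeightLex n μ))
    (j : ℕ) [NeZero (n + j)] (hj : 2 * (n + 1) ^ 10 ≤ j) :
    orbitMultiplicity ℂ (detFormLex ℂ (n + j)) (n + j) (partitionWeightLex (n + j) (rowLift μ j)) =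
      plethysmCoeff ℂ (MatIdx (n + j)) (n + j) (partitionWeightLex (n + j) (rowLift μ j)) := by
  apply le_antisymm
  · exact orbitMultiplicity_le_plethysmCoeff_holds _ (NeZero.ne (n + j)) (detFormLex_isHomogeneous ℂ (n + j)) _
  · rw [plethysmCoeff_rowLift_eq μ hμ h₂ j]
    exact hfree.trans (det_paddingMonotone n δ μ hμ j hj)

/-- **Exact stability from an explicit threshold on equation-free inner types**: under the hypotheses of
`det_ray_eq_plethysm_of_eqFree_base`, `K(j) = K_n(μ*)` (`= a_μ(δ[n])`) for every `j ≥ 2(n+1)^10`.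
[this crux, k4 + k16] -/
theorem det_ray_eq_base_of_eqFree_base (n δ : ℕ) [NeZero n] (μ : Nat.Partition (n * δ))
    (hμ : μ.parts.card ≤ n * n) (h₂ : μ.sortedParts.getD 1 0 ≤ n)
    (hfree : plethysmCoeff ℂ (MatIdx n) n (partitionWeightLex n μ) ≤
      orbitMultiplicity ℂ (detFormLex ℂ n) n (partitionWeightLex n μ))
    (j : ℕ) [NeZero (n + j)] (hj : 2 * (n + 1) ^ 10 ≤ j) :
    orbitMultiplicity ℂ (detFormLex ℂ (n + j)) (n + j) (partitionWeightLex (n + j) (rowLift μ j)) =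
      orbitMultiplicity ℂ (detFormLex ℂ n) n (partitionWeightLex n μ) := by
  rw [det_ray_eq_plethysm_of_eqFree_base n δ μ hμ h₂ hfree j hj, plethysmCoeff_rowLift_eq μ hμ h₂ j]
  exact le_antisymm hfree
    (orbitMultiplicity_le_plethysmCoeff_holds _ (NeZero.ne n) (detFormLex_isHomogeneous ℂ n) _)

/-- **Equations on the ray descend to the inner determinant** (contrapositive of the propagation):
if `μ₂ ≤ n`, `j ≥ 2(n+1)^10` and `Det_{n+j}` HAS an equation of type `(μ♯(n+j))*` in degree `δ`
(`K(j) < a(j)`), then `Det_n` has an equation of type `μ*` in degree `δ` (`K_n(μ*) < a_μ(δ[n])`).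
[this crux, k4 + k16] -/
theorem det_base_lt_plethysm_of_ray_lt (n δ : ℕ) [NeZero n] (μ : Nat.Partition (n * δ))
    (hμ : μ.parts.card ≤ n * n) (h₂ : μ.sortedParts.getD 1 0 ≤ n)
    (j : ℕ) [NeZero (n + j)] (hj : 2 * (n + 1) ^ 10 ≤ j)
    (hlt : orbitMultiplicity ℂ (detFormLex ℂ (n + j)) (n + j) (partitionWeightLex (n + j) (rowLift μ j)) <
      plethysmCoeff ℂ (MatIdx (n + j)) (n + j) (partitionWeightLex (n + j) (rowLift μ j))) :
    orbitMultiplicity ℂ (detFormLex ℂ n) n (partitionWeightLex n μ) <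
      plethysmCoeff ℂ (MatIdx n) n (partitionWeightLex n μ) := by
  by_contra hge
  rw [not_lt] at hge
  exact (lt_irrefl _) (hlt.trans_le (le_of_eq (det_ray_eq_plethysm_of_eqFree_base n δ μ hμ h₂ hge j hj).symm))

/-- **No flip on the ray of an equation-free inner type beyond the threshold, against every padded
permanent.**  If `Det_n` has no equation of type `μ*` in degree `δ` and `μ₂ ≤ n`, then for every
`j ≥ 2(n+1)^10` and every inner size `n' ≤ n + j`:
`mult_{(μ♯)*} ℂ[Δ_{n+j}(X₀₀^{n+j-n'} per_{n'})] ≤ K(j)` (plethysm bound `= a(j) = K(j)`). An effective,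
ray-wise form of `no_flip_of_eqFree`: tail witnesses `μ♯(m-n)` on Kadish–Landsberg rays need inner shapes `μ`
that are TYPES OF EQUATIONS of the inner determinant `Det_n` (or `μ₂ > n`). [BLMW 2011 §4.4, §6.4;
this crux, k4 + k16] -/
theorem paddedPer_le_det_ray_of_eqFree_base (n δ : ℕ) [NeZero n] (μ : Nat.Partition (n * δ))
    (hμ : μ.parts.card ≤ n * n) (h₂ : μ.sortedParts.getD 1 0 ≤ n)
    (hfree : plethysmCoeff ℂ (MatIdx n) n (partitionWeightLex n μ) ≤
      orbitMultiplicity ℂ (detFormLex ℂ n) n (partitionWeightLex n μ))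
    (j : ℕ) [NeZero (n + j)] (hj : 2 * (n + 1) ^ 10 ≤ j) {n' : ℕ} (hn' : n' ≤ n + j) :
    orbitMultiplicity ℂ (paddedPerFormLex ℂ n' (n + j)) (n + j) (partitionWeightLex (n + j) (rowLift μ j)) ≤
      orbitMultiplicity ℂ (detFormLex ℂ (n + j)) (n + j) (partitionWeightLex (n + j) (rowLift μ j)) := by
  rw [det_ray_eq_plethysm_of_eqFree_base n δ μ hμ h₂ hfree j hj]
  exact orbitMultiplicity_le_plethysmCoeff_holds _ (NeZero.ne (n + j)) (paddedPerFormLex_isHomogeneous ℂ hn') _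

end

end Summit.ValiantsHypothesis.ValiantsHypothesis.Theorems.ValuativeFlip
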